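import Summits.Ventures.PercRepro.RLSRuleTwoLinesGeom
import Summits.Ventures.PercRepro.RLSZeroWorld2

/-!
# PercRepro — `R₃⁺` at `t = 0` on the `5`-point plane «two `3`-point lines through a point», every `p ≥ 8`
(night-3, gen 3)

Its `14` rank-`3` subsets each pay `Φ(p, 3)`: the `8` triples and the `4`-set through neither line have no loss
(triple share); the four `4`-sets `ℓ ∪ {x}` / `ℓ′ ∪ {x}` lose only to the coplanar triple of their line
(`sum_good_four_ge`); `G` itself loses to BOTH coplanar triples — the new lifted certificate `U0.zero_l3five2`:
`8 (z₂ − 2 lost₅) ≥ Φ(p, 3)` (`RLSZeroWorld2`, generated by the lane's `zero_poly.py`).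

* `sum_good_both_ge`: the witnesses containing neither coplanar triple give `8 (z₂ − 2 lost₅) ≥ Φ` (union bound);
* `exists_good_triple`: a `3`-subset of `K` whose non-supersets are good witnesses for a line;
* **`perFlat_twoLines`** — `Φ(p, 3) · #U_G ≤ Σ_{S ∈ Yq} w⁺(G, S)` for `G = ℓ ∪ ℓ′` of type `0` and every `p ≥ 8`.
With `perFlat_three_point`, `perFlat_lineFree`, `perFlat_three_line_point` and `perFlat_oneLine`, the per-flat
inequality of `R₃⁺` at `t = 0` is a kernel theorem on EVERY plane of the six types `𝒯₀` (every simple plane with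
`≤ 5` points and no `4`-point line), every `p ≥ 8`.
Imports `RLSRuleTwoLinesGeom`, `RLSZeroWorld2`.  Axioms: standard.
-/

open scoped Matroid

namespace PercRepro

namespace NightThree

open Finset ThmH PerFlat

variable {α : Type*} [DecidableEq α] {M : Matroid α} [M.Finite]

/-! ### The accounting -/

/-- The witnesses containing neither of two `3`-subsets `C`, `C′` of `K` pay `8 (z₂ − 2 lost₅) ≥ Φ(p, 3)`. -/
theorem sum_good_both_ge {K C C' : Finset α} {n : ℕ} (hn : 4 ≤ n) (hK : K.card = n + 4) (hC : C ⊆ K)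
    (hCc : C.card = 3) (hC' : C' ⊆ K) (hC'c : C'.card = 3) :
    phiK (n + 4) 3 ≤ ∑ X ∈ (witnessFamily K n).filter (fun X => ¬ C ⊆ X ∧ ¬ C' ⊆ X),
      8 / (((5 + X.card).choose 3 : ℕ) : ℚ) := by
  classical
  set f : Finset α → ℚ := fun X => 8 / (((5 + X.card).choose 3 : ℕ) : ℚ) with hf
  have hfnn : ∀ X, 0 ≤ f X := fun X => by rw [hf]; positivity
  have hfull : ∑ X ∈ witnessFamily K n, f X = 8 * U0.z2Sum n := by
    rw [hf, sum_witnessFamily K n (fun x => 8 / (((5 + x).choose 3 : ℕ) : ℚ)), hK]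
    unfold U0.z2Sum
    rw [Finset.mul_sum]
    apply Finset.sum_congr rfl
    intro i _
    rw [show 5 + (i + 1) = i + 6 by omega]
    ring
  have hlost : ∀ D ⊆ K, D.card = 3 →
      ∑ X ∈ (witnessFamily K n).filter (fun X => D ⊆ X), f X = 8 * U0.lost5Sum n := by
    intro D hD hDc
    rw [hf, sum_filter_subset_witnessFamily (by omega) hK hD hDc (fun x => 8 / (((5 + x).choose 3 : ℕ) : ℚ))]
    unfold U0.lost5Sum
    rw [Finset.mul_sum]
    apply Finset.sum_congr rfl
    intro j _
    rw [show 5 + (j + 3) = j + 8 by omega]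
    ring
  -- the bad witnesses: a union bound
  have hbad : ∑ X ∈ (witnessFamily K n).filter (fun X => ¬ (¬ C ⊆ X ∧ ¬ C' ⊆ X)), f X ≤
      16 * U0.lost5Sum n := by
    have hfilt : (witnessFamily K n).filter (fun X => ¬ (¬ C ⊆ X ∧ ¬ C' ⊆ X)) =
        (witnessFamily K n).filter (fun X => C ⊆ X) ∪ (witnessFamily K n).filter (fun X => C' ⊆ X) := by
      ext X
      rw [Finset.mem_union, Finset.mem_filter, Finset.mem_filter, Finset.mem_filter]
      tauto
    rw [hfilt]
    have h1 := Finset.sum_union_inter (s₁ := (witnessFamily K n).filter (fun X => C ⊆ X))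
      (s₂ := (witnessFamily K n).filter (fun X => C' ⊆ X)) (f := f)
    have h2 : 0 ≤ ∑ X ∈ (witnessFamily K n).filter (fun X => C ⊆ X) ∩ (witnessFamily K n).filter (fun X => C' ⊆ X),
        f X := Finset.sum_nonneg (fun X _ => hfnn X)
    rw [hlost C hC hCc, hlost C' hC' hC'c] at h1
    linarith
  have hsplit := Finset.sum_filter_add_sum_filter_not (witnessFamily K n) (fun X => ¬ C ⊆ X ∧ ¬ C' ⊆ X) f
  have hkey := U0.zero_l3five2 n hn
  have hphi : phiK (n + 4) 3 = ∑ i ∈ range n, ((n + 4).choose (i + 1) : ℚ) / ((i + 4).choose 3 : ℚ) := by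
    unfold phiK
    rw [phiW_eq_phiK_form n]
    rfl
  rw [← hphi] at hkey
  have : ∑ X ∈ (witnessFamily K n).filter (fun X => ¬ C ⊆ X ∧ ¬ C' ⊆ X), f X ≥ phiK (n + 4) 3 := by
    linarith
  exact this

/-- A `3`-subset of `K` whose non-supersets are good witnesses for the line `m` (the coplanar triple of `m` if
there is one, any triple otherwise). -/
theorem exists_good_triple {G m K : Finset α} (hG : G ∈ flatsQ M 3) (hmG : m ⊆ G) (hmr : M.eRk (m : Set α) = 2)
    (hKsub : K ⊆ gr M \ G) (hKind : M.Indep (K : Set α)) (hK3 : 3 ≤ K.card) :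
    ∃ C ⊆ K, C.card = 3 ∧ ∀ X, ¬ C ⊆ X → GoodWitness M m K X := by
  have hmE : m ⊆ gr M := hmG.trans (mem_flatsQ.1 hG).1
  have hKG : Disjoint K G := by
    rw [Finset.disjoint_left]
    intro x hxK hxG
    have := hKsub hxK
    rw [Finset.mem_sdiff] at this
    exact this.2 hxG
  have hoff : ∀ y ∈ K, y ∉ M.closure (m : Set α) := by
    intro y hyK hy
    have hGflat : M.IsFlat (G : Set α) := (mem_flatsQ.1 hG).2.1
    have : y ∈ (G : Set α) := by
      have := M.closure_subset_closure (Finset.coe_subset.2 hmG) hy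
      rwa [hGflat.closure] at this
    exact Finset.disjoint_left.1 hKG hyK (Finset.mem_coe.1 this)
  have hle1 := card_coplanar_triples_le_one hmr hmE hKind hoff
  rcases Finset.eq_empty_or_nonempty (coplanarTriples M m K) with hemp | ⟨C, hC⟩
  · obtain ⟨C, hCK, hCc⟩ := Finset.exists_subset_card_eq hK3
    refine ⟨C, hCK, hCc, fun X _ C' hC' => ?_⟩
    unfold coplanarTriples at hC' hemp
    rw [hemp] at hC'
    exact absurd hC' (Finset.notMem_empty C')
  · have hCK : C ⊆ K := by
      unfold coplanarTriples at hC
      exact (Finset.mem_powersetCard.1 (Finset.mem_filter.1 hC).1).1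
    have hCc : C.card = 3 := by
      unfold coplanarTriples at hC
      exact (Finset.mem_powersetCard.1 (Finset.mem_filter.1 hC).1).2
    refine ⟨C, hCK, hCc, fun X hX C' hC' => ?_⟩
    have : C' = C := by
      unfold coplanarTriples at hC hC'
      exact Finset.card_le_one.1 hle1 C' hC' C hC
    rw [this]
    exact hX

open scoped Classical in
/-- **`R₃⁺` at `t = 0` on the plane «two `3`-point lines through a point»**, every `p ≥ 8`: for `G = ℓ ∪ ℓ′`
(`TwoLines`) with `ρ(E ∖ G) ≥ p`, `Φ(p, 3) · #U_G ≤ Σ_{S ∈ Yq} w⁺(G, S)`. -/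
theorem perFlat_twoLines {G ℓ ℓ' : Finset α} (hG : G ∈ flatsQ M 3) (h : TwoLines M G ℓ ℓ') {n : ℕ}
    (hn : 4 ≤ n) (hK : ((n + 4 : ℕ) : ℕ∞) ≤ M.eRk ((gr M \ G : Finset α) : Set α)) :
    phiK (n + 4) 3 * ((UqG M (n + 4) 3 G).card : ℚ) ≤ ∑ S ∈ Yq M (n + 4) 3, wPlus M G S := by
  obtain ⟨K, hKsub, hKind, hKcard⟩ := exists_indep_compl_card G hK
  have hKG : Disjoint K G := by
    rw [Finset.disjoint_left]
    intro x hxK hxG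
    have := hKsub hxK
    rw [Finset.mem_sdiff] at this
    exact this.2 hxG
  obtain ⟨hℓG, hℓ'G, hℓc, hℓ'c, hℓr, hℓ'r, hne, hGc, hsimple, hind⟩ := h
  have h' : TwoLines M G ℓ ℓ' := ⟨hℓG, hℓ'G, hℓc, hℓ'c, hℓr, hℓ'r, hne, hGc, hsimple, hind⟩
  obtain ⟨C, hCK, hCc, hgoodC⟩ := exists_good_triple hG hℓG hℓr hKsub hKind (by omega)
  obtain ⟨C', hC'K, hC'c, hgoodC'⟩ := exists_good_triple hG hℓ'G hℓ'r hKsub hKind (by omega)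
  -- the family of rank-`3` subsets
  set 𝔅 : Finset (Finset α) := ((G.powerset.filter (fun B => 3 ≤ B.card)).erase ℓ).erase ℓ' with h𝔅
  have h𝔅mem : ∀ B ∈ 𝔅, B ⊆ G ∧ 3 ≤ B.card ∧ B ≠ ℓ ∧ B ≠ ℓ' := by
    intro B hB
    rw [h𝔅, Finset.mem_erase, Finset.mem_erase, Finset.mem_filter, Finset.mem_powerset] at hB
    exact ⟨hB.2.2.1, hB.2.2.2, hB.2.1, hB.1⟩
  have h𝔅rank : ∀ B ∈ 𝔅, B ⊆ G ∧ M.eRk (B : Set α) = 3 := by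
    intro B hB
    obtain ⟨hBG, hBc, hBℓ, hBℓ'⟩ := h𝔅mem B hB
    refine ⟨hBG, ?_⟩
    apply le_antisymm
    · rw [← eRk_eq_three_of_mem_flatsQ' hG]; exact M.eRk_mono (Finset.coe_subset.2 hBG)
    · obtain ⟨T, hTB, hTc, hTind⟩ : ∃ T ⊆ B, T.card = 3 ∧ M.Indep (T : Set α) := by
        rcases Nat.lt_or_ge B.card 4 with h3 | h4
        · have hBc3 : B.card = 3 := by omega
          exact ⟨B, le_rfl, hBc3, hind B (Finset.mem_powersetCard.2 ⟨hBG, hBc3⟩) hBℓ hBℓ'⟩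
        · obtain ⟨L, hLB, hLc⟩ := Finset.exists_subset_card_eq h4
          obtain ⟨T, hTL, hTc, hTind⟩ := exists_indep_triple_of_four h' (hLB.trans hBG) hLc
          exact ⟨T, hTL.trans hLB, hTc, hTind⟩
      rw [← eRk_eq_three_of_indep_card hTind hTc]
      exact M.eRk_mono (Finset.coe_subset.2 hTB)
  -- the demand: at most `#𝔅 = 14`
  have hdem : ((UqG M (n + 4) 3 G).card : ℚ) ≤ (𝔅.card : ℚ) := by
    have hsub : UqG M (n + 4) 3 G ⊆ 𝔅 := by
      intro B hB
      unfold UqG at hB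
      rw [Finset.mem_filter, mem_Uq] at hB
      obtain ⟨⟨_, hB3, _⟩, hBG⟩ := hB
      have hB3' : M.eRk (B : Set α) = 3 := by exact_mod_cast hB3
      rw [h𝔅, Finset.mem_erase, Finset.mem_erase, Finset.mem_filter, Finset.mem_powerset]
      refine ⟨?_, ?_, hBG, three_le_card_of_eRk_eq_three hB3'⟩
      · rintro rfl; rw [hℓ'r] at hB3'; exact absurd hB3' (by norm_num)
      · rintro rfl; rw [hℓr] at hB3'; exact absurd hB3' (by norm_num)
    exact_mod_cast Finset.card_le_card hsub
  -- the share bound per subset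
  set f : Finset α → Finset α → ℚ := fun B X =>
    if ℓ ⊆ B ∨ ℓ' ⊆ B then
      (if (ℓ ⊆ B → ¬ C ⊆ X) ∧ (ℓ' ⊆ B → ¬ C' ⊆ X) then
        (if B.card = 4 then 3 / (((4 + X.card).choose 3 : ℕ) : ℚ) else 8 / (((5 + X.card).choose 3 : ℕ) : ℚ))
        else 0)
    else 1 / (((3 + X.card).choose 3 : ℕ) : ℚ) with hf
  have hsup := supply_ge_of_family hG h𝔅rank hKsub hKind n f (fun B hB X hX => by
    obtain ⟨hBG, hBc, hBℓ, hBℓ'⟩ := h𝔅mem B hB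
    obtain ⟨hXK, _, _⟩ := mem_witnessFamily hX
    have hXind : M.Indep (X : Set α) := hKind.subset (Finset.coe_subset.2 hXK)
    have hXG : Disjoint X G := Finset.disjoint_of_subset_left hXK hKG
    rw [hf]
    dsimp only
    by_cases hline : ℓ ⊆ B ∨ ℓ' ⊆ B
    · rw [if_pos hline]
      by_cases hgd : (ℓ ⊆ B → ¬ C ⊆ X) ∧ (ℓ' ⊆ B → ¬ C' ⊆ X)
      · rw [if_pos hgd]
        have hw := wPlus_ge_of_twoLines hG h' hBG hXind hXG hXK
          ⟨fun hl => hgoodC X (hgd.1 hl), fun hl => hgoodC' X (hgd.2 hl)⟩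
        refine le_trans ?_ hw
        -- `|B′| ∈ {4, 5}`: with one line `ρ₃ = 3` (`|B′| = 4`), with both `ρ₃ = 8` (`B′ = G`)
        have hB4 : 4 ≤ B.card := by
          by_contra hc
          push Not at hc
          have hB3 : B.card = 3 := by omega
          rcases hline with hl | hl
          · exact hBℓ (Finset.eq_of_subset_of_card_le hl (by omega)).symm
          · exact hBℓ' (Finset.eq_of_subset_of_card_le hl (by omega)).symm
        have hB5 : B.card ≤ 5 := by rw [← hGc]; exact Finset.card_le_card hBG
        by_cases h4 : B.card = 4
        · rw [if_pos h4, h4]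
          -- exactly one of the lines is inside `B′` (both would need `5` points)
          have hnotboth : ¬ (ℓ ⊆ B ∧ ℓ' ⊆ B) := by
            rintro ⟨hl, hl'⟩
            have : ℓ ∪ ℓ' ⊆ B := Finset.union_subset hl hl'
            rw [union_eq_of_twoLines hG h'] at this
            have := Finset.card_le_card this
            omega
          have hrho : ((4 : ℕ).choose 3 - (if ℓ ⊆ B then 1 else 0) - (if ℓ' ⊆ B then 1 else 0) : ℕ) = 3 := by
            rcases hline with hl | hl
            · rw [if_pos hl, if_neg (fun hl' => hnotboth ⟨hl, hl'⟩)]; norm_num [Nat.choose]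
            · rw [if_neg (fun hl' => hnotboth ⟨hl', hl⟩), if_pos hl]; norm_num [Nat.choose]
          rw [hrho]
          norm_num
        · have hB5' : B.card = 5 := by omega
          rw [if_neg h4, hB5']
          -- `B′ = G` contains both lines
          have hBG' : B = G := Finset.eq_of_subset_of_card_le hBG (by omega)
          have hl : ℓ ⊆ B := hBG' ▸ hℓG
          have hl' : ℓ' ⊆ B := hBG' ▸ hℓ'G
          rw [if_pos hl, if_pos hl']
          norm_num [Nat.choose]
      · rw [if_neg hgd]
        exact wPlus_nonneg M G (B ∪ X)
    · rw [if_neg hline]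
      push Not at hline
      have hw := wPlus_ge_of_twoLines hG h' hBG hXind hXG hXK
        ⟨fun hl => absurd hl hline.1, fun hl => absurd hl hline.2⟩
      rw [if_neg hline.1, if_neg hline.2, Nat.sub_zero, Nat.sub_zero] at hw
      refine le_trans ?_ hw
      have hB5 : B.card ≤ 5 := by rw [← hGc]; exact Finset.card_le_card hBG
      obtain ⟨m, hm⟩ : ∃ m, B.card = m + 3 := ⟨B.card - 3, by omega⟩
      rw [hm, div_le_div_iff₀ (by exact_mod_cast Nat.choose_pos (by omega : 3 ≤ 3 + X.card))
        (by exact_mod_cast Nat.choose_pos (by omega : 3 ≤ m + 3 + X.card)), one_mul, add_comm 3 X.card]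
      exact choose_three_mul_choose_three_ge m X.card)
  -- every subset pays `Φ`
  have hpay : ∀ B ∈ 𝔅, phiK (n + 4) 3 ≤ ∑ X ∈ witnessFamily K n, f B X := by
    intro B hB
    obtain ⟨hBG, hBc, hBℓ, hBℓ'⟩ := h𝔅mem B hB
    have hB5 : B.card ≤ 5 := by rw [← hGc]; exact Finset.card_le_card hBG
    by_cases hline : ℓ ⊆ B ∨ ℓ' ⊆ B
    · have hB4 : 4 ≤ B.card := by
        by_contra hc
        push Not at hc
        rcases hline with hl | hl
        · exact hBℓ (Finset.eq_of_subset_of_card_le hl (by omega)).symm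
        · exact hBℓ' (Finset.eq_of_subset_of_card_le hl (by omega)).symm
      have hnonneg : ∀ X ∈ witnessFamily K n, 0 ≤ f B X := by
        intro X _
        rw [hf]
        dsimp only
        split_ifs <;> positivity
      by_cases h4 : B.card = 4
      · -- one line inside `B′`; the other not (`5` points would be needed)
        have hnotboth : ¬ (ℓ ⊆ B ∧ ℓ' ⊆ B) := by
          rintro ⟨hl, hl'⟩
          have : ℓ ∪ ℓ' ⊆ B := Finset.union_subset hl hl'
          rw [union_eq_of_twoLines hG h'] at this
          have := Finset.card_le_card this
          omega
        -- the relevant line and its triple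
        obtain ⟨D, hDK, hDc, hgdD⟩ : ∃ D ⊆ K, D.card = 3 ∧ ∀ X, ¬ D ⊆ X →
            ((ℓ ⊆ B → ¬ C ⊆ X) ∧ (ℓ' ⊆ B → ¬ C' ⊆ X)) := by
          rcases hline with hl | hl
          · exact ⟨C, hCK, hCc, fun X hX => ⟨fun _ => hX, fun hl' => absurd ⟨hl, hl'⟩ hnotboth⟩⟩
          · exact ⟨C', hC'K, hC'c, fun X hX => ⟨fun hl' => absurd ⟨hl', hl⟩ hnotboth, fun _ => hX⟩⟩
        have hval : ∀ X ∈ (witnessFamily K n).filter (fun X => ¬ D ⊆ X),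
            3 / (((4 + X.card).choose 3 : ℕ) : ℚ) ≤ f B X := by
          intro X hX
          rw [Finset.mem_filter] at hX
          rw [hf]
          dsimp only
          rw [if_pos hline, if_pos (hgdD X hX.2), if_pos h4]
        calc phiK (n + 4) 3 ≤ ∑ X ∈ (witnessFamily K n).filter (fun X => ¬ D ⊆ X),
              3 / (((4 + X.card).choose 3 : ℕ) : ℚ) := sum_good_four_ge hn hKcard hDK hDc
          _ ≤ ∑ X ∈ (witnessFamily K n).filter (fun X => ¬ D ⊆ X), f B X := Finset.sum_le_sum hval
          _ ≤ ∑ X ∈ witnessFamily K n, f B X :=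
              Finset.sum_le_sum_of_subset_of_nonneg (Finset.filter_subset _ _) (fun X hX _ => hnonneg X hX)
      · -- `B′ = G`: both lines, both triples
        have hB5' : B.card = 5 := by omega
        have hBG' : B = G := Finset.eq_of_subset_of_card_le hBG (by omega)
        have hl : ℓ ⊆ B := hBG' ▸ hℓG
        have hl' : ℓ' ⊆ B := hBG' ▸ hℓ'G
        have hval : ∀ X ∈ (witnessFamily K n).filter (fun X => ¬ C ⊆ X ∧ ¬ C' ⊆ X),
            8 / (((5 + X.card).choose 3 : ℕ) : ℚ) ≤ f B X := by
          intro X hX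
          rw [Finset.mem_filter] at hX
          rw [hf]
          dsimp only
          rw [if_pos hline, if_pos ⟨fun _ => hX.2.1, fun _ => hX.2.2⟩, if_neg h4]
        calc phiK (n + 4) 3 ≤ ∑ X ∈ (witnessFamily K n).filter (fun X => ¬ C ⊆ X ∧ ¬ C' ⊆ X),
              8 / (((5 + X.card).choose 3 : ℕ) : ℚ) := sum_good_both_ge hn hKcard hCK hCc hC'K hC'c
          _ ≤ ∑ X ∈ (witnessFamily K n).filter (fun X => ¬ C ⊆ X ∧ ¬ C' ⊆ X), f B X := Finset.sum_le_sum hval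
          _ ≤ ∑ X ∈ witnessFamily K n, f B X :=
              Finset.sum_le_sum_of_subset_of_nonneg (Finset.filter_subset _ _) (fun X hX _ => hnonneg X hX)
    · have hval : ∀ X ∈ witnessFamily K n, f B X = 1 / (((3 + X.card).choose 3 : ℕ) : ℚ) := by
        intro X _
        rw [hf]
        dsimp only
        rw [if_neg hline]
      rw [Finset.sum_congr rfl hval, sum_witness_eq_phiK hKcard]
  calc phiK (n + 4) 3 * ((UqG M (n + 4) 3 G).card : ℚ)
      ≤ phiK (n + 4) 3 * (𝔅.card : ℚ) := mul_le_mul_of_nonneg_left hdem (phiK_nonneg _ _)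
    _ = ∑ B ∈ 𝔅, phiK (n + 4) 3 := by rw [Finset.sum_const, nsmul_eq_mul, mul_comm]
    _ ≤ ∑ B ∈ 𝔅, ∑ X ∈ witnessFamily K n, f B X := Finset.sum_le_sum hpay
    _ ≤ ∑ S ∈ Yq M (n + 4) 3, wPlus M G S := hsup

end NightThree

end PercRepro
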